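import Summits.FinalStateConjecture.FinalStateConjecture.Theses.PhaseMixingCapture
import Literature.Geometry.Lorentzian.BondiMomentumCD
import Literature.Geometry.Lorentzian.StabilityCauchy

/-!
# Sketch — crux-ideate `stmt-FinalStateConjecture-10696` (`PhaseMixingCapture.BulkKerrCapture`),
ideator 1, round 1 (2026-08-16).

First lemmas of the three idea cards, over existing declarations only:

* `CaptureBodyMod` — the inner body of the crux with an abstract parameter modulus `μ`;
  `bulk_iff` certifies (by `Iff.rfl`) that `BulkKerrCapture` is the `μ = C·√dist` instance with the
  crux's quantifier prefix.
* Card `two-centre-lebesgue-cover`: `TwoCentreKerrCapture` (the shape of Hintz, arXiv:2606.28253,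
  Thm. 13.1 + Remark 13.2: one `(ε, C)` serves every centre `b₁` in a ball around `b₀`, inner boundary
  `r = m₀` kept; normalised spin `χ = a/M`) and `firstLemmaC1_holds` (PROVED): two-centre capture +
  exponent monotonicity ⇒ the crux's matrix with uniform `(s, δ, k, ε, C)` on `|a| ≤ a₁M`, by a finite
  subcover of the compact segment `[−a₁, a₁] ⊂ (−1, 1)`; `uniform_of_locally_uniform` is its
  one-parameter shadow.
* Card `recoil-budget-modulus`: `restMass_pinch` (PROVED from the tree's Bondi four-momentum API:
  with `P_ADM = 0`, `E_ADM − 2·E_rad ≤ M_B(+∞) ≤ E_ADM − E_rad`) and `spin_pinch` (PROVED, real algebra).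
* Card `frozen-charge-flat-modulus`: `CaptureBodyMod.mono` (PROVED) and `lin_le_sqrt_modulus`
  (PROVED): a linear modulus `C·dist` on a ball of radius `ε ≤ 1` implies the crux's `C·√dist`;
  `firstLemmaC3_holds`, and the composite `bulk_of_lipschitzTwoCentre` (cards 1 + 3 end to end).
-/

open Literature.Geometry.Lorentzian
open scoped Manifold ContDiff Topology
open Set Filter

noncomputable section

set_option linter.dupNamespace false

namespace Summit.FinalStateConjecture.FinalStateConjecture.Cruxes.BulkKerrCapture.Ideator1

open Summit.FinalStateConjecture.FinalStateConjecture.Theses.PhaseMixingCapture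

/-! ### The crux body with an abstract modulus -/

section Body

variable [Kerr.Facts] [Kerr.SliceFacts]

/-- The inner body of `BulkKerrCapture` at exponents `(s, δ, k)`, mass `M`, basin `ε`, spin `a`, with the
final-parameter clause `|M' − M| + |a' − a| ≤ μ(dist)` for an abstract modulus `μ : ENNReal → ℝ`
(verbatim the crux text otherwise, inlined far-origin sojourn clause included). -/
def CaptureBodyMod (μ : ENNReal → ℝ) (s : ℕ) (δ : ℝ) (k : ℕ) (M : ℝ) (hM : 0 < M) (ε a : ℝ) : Prop :=
  ∀ (D : InitialDataSet 𝓘(ℝ, E3) (Kerr.slice a M)) [D.metric.HasLeviCivita],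
    D.IsVacuumConstraintSolution →
    InitialDataSet.dataWeightedSobolevEDist s δ D (Kerr.data M a M hM.le) < ENNReal.ofReal ε →
    ∀ 𝒟 : VacuumCauchyDevelopment D, 𝒟.IsMaximal →
      ∃ (M' a' : ℝ) (𝒟oc : Set 𝒟.carrier), Kerr.IsSubextremal M' a' ∧
        (∀ [𝒟.metric.HasLeviCivita], ∃ B₀ : Set (Kerr.slice a M), IsCompact B₀ ∧ ∀ σ : ℝ, 0 < σ →
          ∃ B₁ : Set (Kerr.slice a M), IsCompact B₁ ∧
            ∀ q ∈ {q : Kerr.slice a M | Kerr.afRadius a M + 1 ≤ ‖(q : E3)‖}, q ∉ B₁ →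
              ∀ (ray : ℝ → 𝒟.carrier) (dom : Set ℝ),
                𝒟.metric.IsNormalisedNullRayFrom 𝒟.timeOrientation 𝒟.embed 𝒟.normal q ray dom →
                  ¬ BddAbove dom ∨ ENNReal.ofReal σ ≤
                    sojournTime ray dom (𝒟.metric.causalFuture 𝒟.timeOrientation (𝒟.embed '' B₀))) ∧
        𝒟.toSpacetime.ConvergesToKerr 𝒟oc M' a' k ∧
        |M' - M| + |a' - a| ≤
          μ (InitialDataSet.dataWeightedSobolevEDist s δ D (Kerr.data M a M hM.le))

/-- The crux's modulus: `μ_C(d) = C · √d`. -/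
def sqrtModulus (C : ℝ) (d : ENNReal) : ℝ := C * √d.toReal

/-- A linear modulus: `μ_C(d) = C · d` (what a tame Nash–Moser estimate delivers). -/
def linModulus (C : ℝ) (d : ENNReal) : ℝ := C * d.toReal

/-- Monotonicity of the body in the modulus on the ball: if `μ ≤ μ'` on `{d < ε}` then the body with
`μ` implies the body with `μ'` (everything else unchanged). PROVED. -/
theorem CaptureBodyMod.mono {μ μ' : ENNReal → ℝ} {s : ℕ} {δ : ℝ} {k : ℕ} {M : ℝ} {hM : 0 < M}
    {ε a : ℝ} (hμ : ∀ d : ENNReal, d < ENNReal.ofReal ε → μ d ≤ μ' d)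
    (h : CaptureBodyMod μ s δ k M hM ε a) : CaptureBodyMod μ' s δ k M hM ε a := by
  intro D _ hvac hdist 𝒟 hmax
  obtain ⟨M', a', 𝒟oc, hsub, hfar, hconv, hmod⟩ := h D hvac hdist 𝒟 hmax
  exact ⟨M', a', 𝒟oc, hsub, hfar, hconv, hmod.trans (hμ _ hdist)⟩

/-- The body is antitone in the basin radius. PROVED. -/
theorem CaptureBodyMod.anti_radius {μ : ENNReal → ℝ} {s : ℕ} {δ : ℝ} {k : ℕ} {M : ℝ} {hM : 0 < M}
    {ε ε' a : ℝ} (hε : ε' ≤ ε) (h : CaptureBodyMod μ s δ k M hM ε a) :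
    CaptureBodyMod μ s δ k M hM ε' a :=
  fun D _ hvac hdist 𝒟 hmax ↦ h D hvac (hdist.trans_le (ENNReal.ofReal_le_ofReal hε)) 𝒟 hmax

/-- The disprover's matrix (`Cruxes/BulkKerrCapture/Disproof.lean`, §1 `CaptureAt`, cycle 1,
2026-08-16), copied verbatim (that workfile is not a built module, so it cannot be imported here):
far-completeness spelled `DataEmbedding.HasCompleteFutureNullInfinityFar`, `hM : 0 ≤ M`. -/
def CaptureAt (s : ℕ) (δ : ℝ) (k : ℕ) (M : ℝ) (hM : 0 ≤ M) (ε C a : ℝ) : Prop :=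
  ∀ (D : InitialDataSet 𝓘(ℝ, E3) (Kerr.slice a M)) [D.metric.HasLeviCivita],
    D.IsVacuumConstraintSolution →
    InitialDataSet.dataWeightedSobolevEDist s δ D (Kerr.data M a M hM) < ENNReal.ofReal ε →
    ∀ 𝒟 : VacuumCauchyDevelopment D, 𝒟.IsMaximal →
      ∃ (M' a' : ℝ) (𝒟oc : Set 𝒟.carrier), Kerr.IsSubextremal M' a' ∧
        𝒟.HasCompleteFutureNullInfinityFar ∧
        𝒟.toSpacetime.ConvergesToKerr 𝒟oc M' a' k ∧
        |M' - M| + |a' - a| ≤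
          C * √(InitialDataSet.dataWeightedSobolevEDist s δ D (Kerr.data M a M hM)).toReal

omit [Kerr.Facts] [Kerr.SliceFacts] in
/-- The closed far region of the slice as a subset of the slice (as in the Disproof file). -/
theorem range_farSliceIncl (a r₀ : ℝ) :
    range (Kerr.farSliceIncl a r₀) = {q : Kerr.slice a r₀ | Kerr.afRadius a r₀ + 1 ≤ ‖(q : E3)‖} := by
  ext q
  constructor
  · rintro ⟨y, rfl⟩
    exact y.2
  · intro hq
    exact ⟨⟨(q : E3), hq⟩, Subtype.ext rfl⟩

/-- **Correspondence with the Disproof file (PROVED):** the `C·√dist` instance of `CaptureBodyMod`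
is the disprover's `CaptureAt` — so every `_false_without_` lemma there speaks about these bodies. -/
theorem captureBodyMod_sqrt_iff_captureAt {s : ℕ} {δ : ℝ} {k : ℕ} {M : ℝ} {hM : 0 < M}
    {ε C a : ℝ} : CaptureBodyMod (sqrtModulus C) s δ k M hM ε a ↔ CaptureAt s δ k M hM.le ε C a := by
  simp only [CaptureBodyMod, CaptureAt, sqrtModulus, DataEmbedding.HasCompleteFutureNullInfinityFar,
    DataEmbedding.HasCompleteFutureNullInfinityFrom, range_farSliceIncl]

end Body

/-- `BulkKerrCapture` is, definitionally, the `C·√dist` instance of `CaptureBodyMod` under the crux's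
quantifier prefix `∀ a₁ < 1, ∃ (s, δ, k), ∀ M > 0, ∃ ε > 0, ∃ C, ∀ |a| ≤ a₁M`. -/
theorem bulk_iff :
    BulkKerrCapture ↔
      ∀ [Kerr.Facts] [Kerr.SliceFacts], ∀ a₁ : ℝ, a₁ < 1 → ∃ (s : ℕ) (δ : ℝ) (k : ℕ),
        ∀ (M : ℝ) (hM : 0 < M), ∃ ε > (0 : ℝ), ∃ C : ℝ, ∀ a : ℝ, |a| ≤ a₁ * M →
          CaptureBodyMod (sqrtModulus C) s δ k M hM ε a :=
  Iff.rfl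

/-! ### Card 1 `two-centre-lebesgue-cover` -/

section TwoCentre

variable [Kerr.Facts] [Kerr.SliceFacts]

/-- **Two-centre Kerr capture** (the shape of Hintz, arXiv:2606.28253, Thm. 13.1 with Remark 13.2,
in the tree's consequence form at the inner radius `r₀ = M`), written in the NORMALISED spin
`χ = a/M` (scaling covariance of the vacuum equations: Hintz's exponents `d`, the spin radius and
all dimensionless constants depend on `b₀ = (m₀, a₀)` only through `a₀/m₀`): for every
sub-extremal centre `χ₀` there are exponents `(s, δ, k)` and a spin radius `η > 0` such that for every
mass `M > 0` ONE basin `ε > 0` and ONE modulus constant `C` serve EVERY spin `a` with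
`|a/M − χ₀| < η`, `|a| < M`, each on its own leaf `Kerr.slice a M`. (Remark 13.2: "Theorem 13.1
remains valid if … we replace `b₀` with parameters `b₁` satisfying `|b₁ − b₀| < ε` … the particular
choice `r = m₀` … is still acceptable as long as `m₀ ∈ (r⁻_{b₁}, r⁺_{b₁})`" — here the mass is
constant along the spin segment, so `r₀ = M` never moves.) To be vendored as a named fact. -/
def TwoCentreKerrCapture : Prop :=
  ∀ χ₀ : ℝ, |χ₀| < 1 → ∃ (s : ℕ) (δ : ℝ) (k : ℕ), ∃ η > (0 : ℝ), ∀ (M : ℝ) (hM : 0 < M),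
    ∃ ε > (0 : ℝ), ∃ C : ℝ, ∀ a : ℝ, |a / M - χ₀| < η → |a| < M →
      CaptureBodyMod (sqrtModulus C) s δ k M hM ε a

/-- Monotonicity of the body in the exponents (needed because the vendored exponents vary with the
centre): larger `(s, δ)` shrink the data ball (`dataWeightedSobolevEDist` is monotone in `s` and in
`δ` since `1 + ‖x‖ ≥ 1`), smaller `k` weakens `Cᵏ` convergence (`ConvergesTo.of_le`), larger
`C ≥ 0` weakens the modulus. Routine; a support stub of the line, not proved here. -/
def BodyMonoExponents : Prop :=
  ∀ (s s' : ℕ) (δ δ' : ℝ) (k k' : ℕ) (M : ℝ) (hM : 0 < M) (ε C C' a : ℝ),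
    s ≤ s' → δ ≤ δ' → k' ≤ k → 0 ≤ C → C ≤ C' →
      CaptureBodyMod (sqrtModulus C) s δ k M hM ε a →
        CaptureBodyMod (sqrtModulus C') s' δ' k' M hM ε a

/-- **First lemma of card 1** (typed target): two-centre capture + exponent monotonicity ⇒ the crux's
matrix under the crux's quantifier prefix. PROVED below (`firstLemmaC1_holds`). -/
def FirstLemmaC1 : Prop :=
  BodyMonoExponents → TwoCentreKerrCapture →
    ∀ a₁ : ℝ, a₁ < 1 → ∃ (s : ℕ) (δ : ℝ) (k : ℕ), ∀ (M : ℝ) (hM : 0 < M),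
      ∃ ε > (0 : ℝ), ∃ C : ℝ, ∀ a : ℝ, |a| ≤ a₁ * M → CaptureBodyMod (sqrtModulus C) s δ k M hM ε a

/-- **PROOF of the first lemma of card 1: the crux's uniform `(s, δ, k, ε, C)` on `|a| ≤ a₁M` is a
finite-subcover extraction from two-centre capture** (cover the compact segment of normalised spins
`[−a₁, a₁] ⊂ (−1, 1)` by the spin balls, take `max s`, `max δ`, `min k` over the finite subcover —
these do not depend on `M` — and, for each `M`, `min ε(M)`, `max C(M)⁺`). The strict spin gap
`a₁ < 1` is used exactly once: `[−a₁, a₁]` lies in the open interval where centres exist. -/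
theorem firstLemmaC1_holds : FirstLemmaC1 := by
  intro hmono h2 a₁ ha₁
  classical
  -- vacuous case `a₁ < 0`
  rcases lt_or_ge a₁ 0 with hneg | hnn
  · refine ⟨0, 0, 0, fun M hM ↦ ⟨1, one_pos, 0, fun a ha ↦ ?_⟩⟩
    exfalso
    have : a₁ * M < 0 := mul_neg_of_neg_of_pos hneg hM
    linarith [abs_nonneg a]
  -- the compact segment of normalised spins and the two-centre data on it
  set K : Set ℝ := Icc (-a₁) a₁ with hK
  have hKc : IsCompact K := isCompact_Icc
  have hKsub : ∀ χ ∈ K, |χ| < 1 := fun χ hχ ↦ by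
    rw [hK, mem_Icc] at hχ
    exact abs_lt.2 ⟨by linarith [hχ.1], by linarith [hχ.2]⟩
  choose! s δ k η hη hcap using fun χ (hχ : χ ∈ K) ↦ h2 χ (hKsub χ hχ)
  have hcover : K ⊆ ⋃ χ ∈ K, Metric.ball χ (η χ) := fun χ hχ ↦
    mem_biUnion hχ (Metric.mem_ball_self (hη χ hχ))
  obtain ⟨t, htK, htfin, hsub⟩ :=
    hKc.elim_finite_subcover_image (fun χ _ ↦ Metric.isOpen_ball) hcover
  have hKne : K.Nonempty := ⟨0, by rw [hK, mem_Icc]; exact ⟨by linarith, hnn⟩⟩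
  have htne : t.Nonempty := by
    obtain ⟨x, hx⟩ := hKne
    have hx' := hsub hx
    simp only [mem_iUnion] at hx'
    obtain ⟨i, hi, -⟩ := hx'
    exact ⟨i, hi⟩
  -- exponents uniform over the finite subcover (independent of `M`)
  obtain ⟨is, -, hsmax⟩ := t.exists_max_image s htfin htne
  obtain ⟨id, -, hdmax⟩ := t.exists_max_image δ htfin htne
  obtain ⟨ik, -, hkmin⟩ := t.exists_min_image k htfin htne
  refine ⟨s is, δ id, k ik, fun M hM ↦ ?_⟩
  -- per-`M` basin and constant over the finite subcover
  choose! ε hε C hC using fun χ (hχ : χ ∈ t) ↦ hcap χ (htK hχ) M hM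
  obtain ⟨ie, hiet, hemin⟩ := t.exists_min_image ε htfin htne
  obtain ⟨ic, -, hcmax⟩ := t.exists_max_image (fun χ ↦ max (C χ) 0) htfin htne
  refine ⟨ε ie, hε ie hiet, max (C ic) 0, fun a ha ↦ ?_⟩
  -- locate the normalised spin `a/M` in the cover
  have hχK : a / M ∈ K := by
    rw [hK, mem_Icc, ← abs_le, abs_div, abs_of_pos hM, div_le_iff₀ hM]
    exact ha
  have ha' := hsub hχK
  simp only [mem_iUnion] at ha'
  obtain ⟨χ, hχt, hball⟩ := ha'
  have hdist : |a / M - χ| < η χ := by simpa [Metric.mem_ball, Real.dist_eq] using hball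
  have halt : |a| < M := by
    have : a₁ * M < 1 * M := mul_lt_mul_of_pos_right ha₁ hM
    linarith
  have hbody := hC χ hχt a hdist halt
  -- lift `C χ` to `max (C χ) 0`, then monotonicity in exponents and in the radius
  have hbody' : CaptureBodyMod (sqrtModulus (max (C χ) 0)) (s χ) (δ χ) (k χ) M hM (ε χ) a :=
    hbody.mono fun d _ ↦
      mul_le_mul_of_nonneg_right (le_max_left _ _) (Real.sqrt_nonneg _)
  have hbody'' := hmono (s χ) (s is) (δ χ) (δ id) (k χ) (k ik) M hM (ε χ) (max (C χ) 0)
    (max (C ic) 0) a (hsmax χ hχt) (hdmax χ hχt) (hkmin χ hχt) (le_max_right _ _) (hcmax χ hχt)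
    hbody'
  exact hbody''.anti_radius (hemin χ hχt)

end TwoCentre

/-- **Topological core of card 1 in abstract form (PROVED): locally uniform ⇒ uniform on compacts.**
If a property `P a ε` of a spin `a` and a basin `ε` is antitone in `ε` and holds two-centre-locally
(around every `a₀ ∈ K` one `ε` serves a whole neighbourhood of spins), then on a compact `K` one
`ε` serves all. (The one-parameter shadow of `firstLemmaC1_holds`.) -/
theorem uniform_of_locally_uniform {K : Set ℝ} (hK : IsCompact K) {P : ℝ → ℝ → Prop}
    (hP : ∀ a ε ε', ε' ≤ ε → P a ε → P a ε')
    (hloc : ∀ a₀ ∈ K, ∃ η > (0 : ℝ), ∃ ε > (0 : ℝ), ∀ a, |a - a₀| < η → P a ε) :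
    ∃ ε > (0 : ℝ), ∀ a ∈ K, P a ε := by
  classical
  choose! η hη ε hε hPε using hloc
  have hcover : K ⊆ ⋃ a₀ ∈ K, Metric.ball a₀ (η a₀) := fun a ha ↦
    mem_biUnion ha (Metric.mem_ball_self (hη a ha))
  obtain ⟨t, htK, htfin, hsub⟩ :=
    hK.elim_finite_subcover_image (fun a₀ _ ↦ Metric.isOpen_ball) hcover
  rcases K.eq_empty_or_nonempty with hKe | hKne
  · exact ⟨1, one_pos, by simp [hKe]⟩
  have htne : t.Nonempty := by
    obtain ⟨x, hx⟩ := hKne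
    have hx' := hsub hx
    simp only [mem_iUnion] at hx'
    obtain ⟨i, hi, -⟩ := hx'
    exact ⟨i, hi⟩
  obtain ⟨a₁, ha₁t, hmin⟩ := t.exists_min_image ε htfin htne
  refine ⟨ε a₁, hε a₁ (htK ha₁t), fun a ha ↦ ?_⟩
  have ha' := hsub ha
  simp only [mem_iUnion] at ha'
  obtain ⟨a₀, ha₀t, hball⟩ := ha'
  have hdist : |a - a₀| < η a₀ := by
    simpa [Metric.mem_ball, Real.dist_eq] using hball
  have hP₀ : P a (ε a₀) := hPε a₀ (htK ha₀t) a hdist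
  exact hP a _ _ (hmin a₀ ha₀t) hP₀

/-! ### Card 2 `recoil-budget-modulus` -/

section Recoil

universe u

variable {X : Type u} [TopologicalSpace X] [ChartedSpace E3 X] [IsManifold (𝓡 3) ∞ X]
  [ConnectedSpace X] {D : InitialDataSet (𝓡 3) X}

/-- **Recoil pinning (PROVED from the tree's Bondi four-momentum API).** For a Cauchy development
carrying a canonical Bondi frame foliation (`BondiMomentumCD.lean`: future-causal four-momentum
loss, positivity, ADM limits) of data with vanishing ADM momentum, the final Bondi REST mass is
pinned by the radiated energy `E_rad = E_ADM − E_B(+∞)` alone: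
`E_ADM − 2·E_rad ≤ M_B(+∞) ≤ E_ADM − E_rad` — the recoil of the final black hole costs at most what
was radiated. In the captured setting `M_B(+∞) = M'` and `E_ADM = M`, so `|M' − M| ≤ 2 E_rad` with
constant `2`, uniformly in the spin. -/
theorem restMass_pinch {𝒟 : CauchyDevelopment D} {𝓕 : 𝒟.BondiFrameFoliation} {e : AFEnd X}
    (hc : 𝓕.IsCanonical e) (hP : AFEnd.admMomentumVec e D = 0) :
    AFEnd.admEnergy e D - 2 * (AFEnd.admEnergy e D - 𝓕.finalBondiEnergy) ≤ 𝓕.finalBondiRestMass ∧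
      𝓕.finalBondiRestMass ≤ AFEnd.admEnergy e D - (AFEnd.admEnergy e D - 𝓕.finalBondiEnergy) := by
  set E := AFEnd.admEnergy e D with hE
  set Ef := 𝓕.finalBondiEnergy with hEf
  set Pf := 𝓕.finalBondiMomentum with hPf
  -- the radiated four-momentum is future causal: ‖P_f‖ = ‖P_ADM − P_f‖ ≤ E − E_f
  have h1 : ‖Pf‖ ≤ E - Ef := by
    have hA := hc.norm_admMomentumVec_sub_bondiMomentum_le 0
    have hB := hc.norm_bondiMomentum_sub_finalBondiMomentum_le 0
    have htri : ‖AFEnd.admMomentumVec e D - Pf‖ ≤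
        ‖AFEnd.admMomentumVec e D - 𝓕.bondiMomentum 0‖ + ‖𝓕.bondiMomentum 0 - Pf‖ := by
      simpa [sub_add_sub_cancel] using
        norm_add_le (AFEnd.admMomentumVec e D - 𝓕.bondiMomentum 0) (𝓕.bondiMomentum 0 - Pf)
    have : ‖AFEnd.admMomentumVec e D - Pf‖ ≤ E - Ef := by linarith
    simpa [hP] using this
  have hEf0 : 0 ≤ Ef := hc.finalBondiEnergy_nonneg
  have hEfE : Ef ≤ E := hc.finalBondiEnergy_le_admEnergy
  refine ⟨?_, ?_⟩
  · -- lower bound: 2 E_f − E ≤ √(E_f² − ‖P_f‖²)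
    have hgoal : E - 2 * (E - Ef) = 2 * Ef - E := by ring
    rw [hgoal]
    show 2 * Ef - E ≤ √(Ef ^ 2 - ‖Pf‖ ^ 2)
    by_cases hpos : 2 * Ef - E ≤ 0
    · exact hpos.trans (Real.sqrt_nonneg _)
    · have hpos' : 0 ≤ 2 * Ef - E := le_of_lt (not_le.mp hpos)
      have hPsq : ‖Pf‖ ^ 2 ≤ (E - Ef) ^ 2 := by
        have h0 : 0 ≤ ‖Pf‖ := norm_nonneg _
        nlinarith
      calc 2 * Ef - E = √((2 * Ef - E) ^ 2) := (Real.sqrt_sq hpos').symm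
        _ ≤ √(Ef ^ 2 - ‖Pf‖ ^ 2) := Real.sqrt_le_sqrt (by nlinarith)
  · -- upper bound: M_B(+∞) ≤ E_B(+∞) = E − E_rad
    have : E - (E - Ef) = Ef := by ring
    rw [this]
    exact hc.finalBondiRestMass_le_finalBondiEnergy

/-- **Spin pinning (PROVED, real algebra).** If the rest mass is pinned, `|m − M| ≤ 2E`, and the
total angular-momentum budget reads `|a'·m − a·M| ≤ J_r` (ADM angular momentum `aM` frozen by the
fast-decay topology; `J_r` = radiated CWY angular momentum + recoil/orbital corrections), then
`|a' − a| ≤ (J_r + 2|a|E)/m`. -/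
theorem spin_pinch {M m a a' E Jr : ℝ} (hm : 0 < m) (hmass : |m - M| ≤ 2 * E)
    (hJ : |a' * m - a * M| ≤ Jr) : |a' - a| ≤ (Jr + 2 * |a| * E) / m := by
  have hrepr : a' - a = ((a' * m - a * M) + a * (M - m)) / m := by
    field_simp
    ring
  rw [hrepr, abs_div, abs_of_pos hm]
  apply div_le_div_of_nonneg_right _ hm.le
  calc |a' * m - a * M + a * (M - m)| ≤ |a' * m - a * M| + |a * (M - m)| := abs_add_le _ _
    _ ≤ Jr + 2 * |a| * E := by
        have h2 : |a * (M - m)| ≤ |a| * (2 * E) := by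
          rw [abs_mul, abs_sub_comm]
          exact mul_le_mul_of_nonneg_left hmass (abs_nonneg a)
        linarith

end Recoil

/-! ### Card 3 `frozen-charge-flat-modulus` -/

section Frozen

variable [Kerr.Facts] [Kerr.SliceFacts]

/-- **Linear ⇒ square-root modulus on a ball of radius `ε ≤ 1` (PROVED).** A Lipschitz final-state
map (modulus `C·dist`, what the tame Nash–Moser estimate of Hintz's Step 3 + [Saint-Raymond 1989]
delivers) gives the crux's `C·√dist` verbatim, since `d ≤ √d` on `[0, 1]` and `C·d ≥ 0` forces
`C ≥ 0` whenever `d > 0`. -/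
theorem lin_le_sqrt_modulus {s : ℕ} {δ : ℝ} {k : ℕ} {M : ℝ} {hM : 0 < M} {ε C a : ℝ}
    (hε : ε ≤ 1) (h : CaptureBodyMod (linModulus C) s δ k M hM ε a) :
    CaptureBodyMod (sqrtModulus C) s δ k M hM ε a := by
  intro D _ hvac hdist 𝒟 hmax
  obtain ⟨M', a', 𝒟oc, hsub, hfar, hconv, hmod⟩ := h D hvac hdist 𝒟 hmax
  refine ⟨M', a', 𝒟oc, hsub, hfar, hconv, hmod.trans ?_⟩
  set d := (InitialDataSet.dataWeightedSobolevEDist s δ D (Kerr.data M a M hM.le)) with hd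
  have hdlt : d < ENNReal.ofReal ε := hdist
  have hd1 : d.toReal ≤ 1 := by
    have hne : d ≠ ⊤ := hdlt.ne_top
    have : d.toReal < ε := (ENNReal.lt_ofReal_iff_toReal_lt hne).1 hdlt
    linarith
  have hd0 : 0 ≤ d.toReal := ENNReal.toReal_nonneg
  show linModulus C d ≤ sqrtModulus C d
  simp only [linModulus, sqrtModulus]
  have hsq : d.toReal ≤ √d.toReal := by
    rcases hd0.eq_or_lt with h0 | hpos
    · simp [← h0]
    · calc d.toReal = √(d.toReal ^ 2) := (Real.sqrt_sq hd0).symm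
        _ ≤ √d.toReal := Real.sqrt_le_sqrt (by nlinarith)
  have habs : 0 ≤ |M' - M| + |a' - a| := by positivity
  rcases hd0.eq_or_lt with h0 | hpos
  · simp [← h0]
  · have hC : 0 ≤ C := by
      by_contra hC
      have hC' : C < 0 := not_le.mp hC
      have : C * d.toReal < 0 := mul_neg_of_neg_of_pos hC' hpos
      exact absurd (habs.trans hmod) (not_le.mpr this)
    exact mul_le_mul_of_nonneg_left hsq hC

/-- **First lemma of card 3** (typed target): the Lipschitz (linear-modulus) two-centre statement —
the honest output of a tame Nash–Moser scheme — implies two-centre capture in the crux's `√` form,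
after shrinking basins to `ε ≤ 1` (`CaptureBodyMod.anti_radius`, `lin_le_sqrt_modulus`). -/
def FirstLemmaC3 : Prop :=
  (∀ χ₀ : ℝ, |χ₀| < 1 → ∃ (s : ℕ) (δ : ℝ) (k : ℕ), ∃ η > (0 : ℝ), ∀ (M : ℝ) (hM : 0 < M),
    ∃ ε > (0 : ℝ), ∃ C : ℝ, ∀ a : ℝ, |a / M - χ₀| < η → |a| < M →
      CaptureBodyMod (linModulus C) s δ k M hM ε a) →
  TwoCentreKerrCapture

/-- PROOF of `FirstLemmaC3` (so card 3 reduces the modulus clause to a Lipschitz statement). -/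
theorem firstLemmaC3_holds : FirstLemmaC3 := by
  intro h χ₀ hχ₀
  obtain ⟨s, δ, k, η, hη, hM⟩ := h χ₀ hχ₀
  refine ⟨s, δ, k, η, hη, fun M hMpos ↦ ?_⟩
  obtain ⟨ε, hε, C, hC⟩ := hM M hMpos
  refine ⟨min ε 1, lt_min hε one_pos, C, fun a ha haM ↦ ?_⟩
  exact lin_le_sqrt_modulus (min_le_right _ _) ((hC a ha haM).anti_radius (min_le_left _ _))

/-- **The whole reduction of cards 1 + 3, kernel-checked**: Lipschitz two-centre capture and exponent
monotonicity imply the crux. -/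
theorem bulk_of_lipschitzTwoCentre (hmono : BodyMonoExponents)
    (hlin : ∀ χ₀ : ℝ, |χ₀| < 1 → ∃ (s : ℕ) (δ : ℝ) (k : ℕ), ∃ η > (0 : ℝ), ∀ (M : ℝ) (hM : 0 < M),
      ∃ ε > (0 : ℝ), ∃ C : ℝ, ∀ a : ℝ, |a / M - χ₀| < η → |a| < M →
        CaptureBodyMod (linModulus C) s δ k M hM ε a) :
    ∀ a₁ : ℝ, a₁ < 1 → ∃ (s : ℕ) (δ : ℝ) (k : ℕ), ∀ (M : ℝ) (hM : 0 < M),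
      ∃ ε > (0 : ℝ), ∃ C : ℝ, ∀ a : ℝ, |a| ≤ a₁ * M → CaptureBodyMod (sqrtModulus C) s δ k M hM ε a :=
  firstLemmaC1_holds hmono (firstLemmaC3_holds hlin)

end Frozen

end Summit.FinalStateConjecture.FinalStateConjecture.Cruxes.BulkKerrCapture.Ideator1

end
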